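import Mathlib
import Summits.SmoothPoincare4.SmoothPoincare4.Theorems.SoloInformedPretzelSurgeryQuotients
import Summits.SmoothPoincare4.SmoothPoincare4.Theorems.SoloInformedBinaryOctahedral

/-!
# Slope `22` on `P(-2,3,9)`: the surgery group maps ONTO the binary octahedral group `O*`,
# the meridian going to an element of order `4`

Solo residency `solo-SmoothPoincare4-informed`, session 114 (CLAIMS C759; Part I-bis
`paper/finite-fibres.md` Corollary C_fin and §4.2 (O)). Companion of
`SoloInformedPretzelSurgeryQuotients` (slopes `17`, `23`, targets `ℤ/p × SL(2,𝔽₅)`) and of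
`SoloInformedBinaryOctahedral` (the model `O* = oList ⊂ SL(2,𝔽₇)`).

`G22 := ⟨x₀, …, x₁₃ ∣ Wirtinger relators of P(-2,3,9), μ²² λ⟩` with the SAME crossing list,
meridian `μ = x₁₁` and longitude word as the slope-`23` group `PretzelSurgery.G23` (only the exponent
of `μ` in the surgery relator changes). We exhibit `ρ22 : G22 →* SL(2,𝔽₇)` (explicit arc images, all
fourteen in the order-`4` class `C₄` of `O* ∖ T*`; found by a 0.1 s search, re-verified here by
`decide`) and prove: its range is EXACTLY the binary octahedral group `O*` (the subgroup `Ostar` with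
carrier `oList`, 48 elements), and `ρ22 μ` has order `4` (`(ρ22 μ)² = -1`).

USE (finite-fibres.md 4.2/4.4). Granted that `π := π₁ S³₂₂(P(-2,3,9)) = G22` is FINITE (`22` is one
of the two finite, non-cyclic surgery slopes of `P(-2,3,9)` [Bleiler–Hodgson 1996; Ichihara–Jong 2009,
Thm 1]; independently `|π| = 528` by two coset enumerations, CLAIMS C715/C718), a surjection onto `O*` forces `π` to be of
octahedral type `O* × ℤ_b` (no other finite 3-manifold group with cyclic `H₁` maps onto `O*`:
cyclic and `D`-types are metabelian, `T`-types have `2`-part `8 < 16`, `I* × ℤ_b` has only cyclic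
solvable quotients), hence `π ≅ O* × ℤ₁₁` (`H₁ = ℤ/22`); and since every surjection
`O* × ℤ₁₁ ↠ O*` is an automorphism of `O*` composed with the projection, the `O*`-component of the
meridian has the order of `ρ22 μ`, namely `4` — so the octahedral invariant is `o = 4` and
`E(τ²²ρ¹P(-2,3,9)) ≅ ± E(τ²T(3,4))` (finite-fibres THEOREM B_fin (O)), without using the
meridian-order computation `ord μ = 44`. Nothing topological is formalised here.
-/

namespace Summit.SmoothPoincare4.SmoothPoincare4.Theorems
namespace PretzelSurgery22

open MatrixGroups PretzelSurgery BinaryOctahedral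

/-! ### The slope-22 surgery group and its representation into `SL(2,𝔽₇)` -/

/-- Relators of the slope-`22` surgery group: the Wirtinger relators of `P(-2,3,9)` and `μ²² λ`. -/
def rels22 : Set (FreeGroup (Fin 14)) :=
  {r | r = mu239 ^ (22 : ℕ) * lam239 ∨ r ∈ crossings239.map wrel}

/-- `G22 = ⟨x₀, …, x₁₃ ∣ Wirtinger relators of P(-2,3,9), μ²² λ⟩ = π₁ S³₂₂(P(-2,3,9))`. -/
abbrev G22 : Type := PresentedGroup rels22

/-- Images of the fourteen arcs in `SL(2,𝔽₇)`: all in the class `C₄` (order `4`) of `O* ∖ T*`. -/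
def M22 : Fin 14 → SL(2, ZMod 7) :=
  ![BinaryOctahedral.sl 3 1 4 4, BinaryOctahedral.sl 1 5 1 6, BinaryOctahedral.sl 2 6 5 5,
    BinaryOctahedral.sl 0 3 2 0, BinaryOctahedral.sl 5 4 4 2, BinaryOctahedral.sl 5 1 2 2,
    BinaryOctahedral.sl 0 4 5 0, BinaryOctahedral.sl 2 3 3 5, BinaryOctahedral.sl 2 6 5 5,
    BinaryOctahedral.sl 0 3 2 0, BinaryOctahedral.sl 2 3 3 5, BinaryOctahedral.sl 0 4 5 0,
    BinaryOctahedral.sl 4 6 3 3, BinaryOctahedral.sl 5 4 4 2]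

/-- Every arc image lies in the order-`4` class `c4 ⊂ oList`. -/
theorem M22_mem_c4 : ∀ i : Fin 14, M22 i ∈ c4 := by decide +kernel

/-- Every arc image lies in `oList`. -/
theorem M22_mem_oList : ∀ i : Fin 14, M22 i ∈ oList := by decide +kernel

/-- The Wirtinger relators hold for the images. -/
theorem M22_wrel :
    ∀ t ∈ crossings239, (M22 t.1)⁻¹ * M22 t.2.1 * M22 t.1 * (M22 t.2.2)⁻¹ = 1 := by
  decide +kernel

/-- The surgery relator `μ²² λ` holds for the images. -/
theorem M22_surgery : FreeGroup.lift M22 (mu239 ^ (22 : ℕ) * lam239) = 1 := by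
  simp only [mu239, lam239, map_mul, map_pow, map_zpow, FreeGroup.lift_apply_of]
  decide +kernel

/-- Every relator is killed. -/
theorem lift_M22_eq_one : ∀ r ∈ rels22, FreeGroup.lift M22 r = 1 := by
  rintro r (rfl | hr)
  · exact M22_surgery
  · obtain ⟨t, ht, rfl⟩ := List.mem_map.mp hr
    rw [lift_wrel]
    exact M22_wrel t ht

/-- `ρ22 : G22 →* SL(2,𝔽₇)`. -/
def ρ22 : G22 →* SL(2, ZMod 7) := PresentedGroup.toGroup lift_M22_eq_one

/-- `ρ22` on generators. -/
theorem ρ22_of (i : Fin 14) : ρ22 (PresentedGroup.of i) = M22 i := PresentedGroup.toGroup.of _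

/-- THE MERIDIAN GOES TO AN ELEMENT OF ORDER `4`: `(ρ22 μ)² = -1` (and `-1 ≠ 1`). -/
theorem ρ22_mu_sq : ρ22 (PresentedGroup.of 11) ^ 2 = -1 ∧ (-1 : SL(2, ZMod 7)) ≠ 1 := by
  rw [ρ22_of]
  decide +kernel

/-! ### The binary octahedral subgroup `Ostar ≤ SL(2,𝔽₇)` with carrier `oList` -/

/-- `oList` is closed under multiplication and inversion and contains `1`. -/
theorem oList_closed :
    (oList.all fun a => oList.all fun b => decide (a * b ∈ oList)) = true ∧
      (oList.all fun a => decide (a⁻¹ ∈ oList)) = true ∧ (1 : SL(2, ZMod 7)) ∈ oList := by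
  decide +kernel

/-- The binary octahedral group as a subgroup of `SL(2,𝔽₇)`: carrier `= oList`. -/
def Ostar : Subgroup (SL(2, ZMod 7)) where
  carrier := {x | x ∈ oList}
  mul_mem' := by
    intro a b ha hb
    have h := oList_closed.1
    simp only [List.all_eq_true, decide_eq_true_eq] at h
    exact h a ha b hb
  one_mem' := oList_closed.2.2
  inv_mem' := by
    intro a ha
    have h := oList_closed.2.1
    simp only [List.all_eq_true, decide_eq_true_eq] at h
    exact h a ha

/-- Membership in `Ostar` is membership in `oList`. -/
theorem mem_Ostar {x : SL(2, ZMod 7)} : x ∈ Ostar ↔ x ∈ oList := Iff.rfl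

/-- `Ostar` has exactly `48` elements. -/
theorem card_Ostar : Nat.card Ostar = 48 := by
  rw [Nat.card_congr (Equiv.subtypeEquivRight (fun x => (by
      rw [mem_Ostar, List.mem_toFinset] : x ∈ Ostar ↔ x ∈ oList.toFinset))),
    Nat.card_eq_fintype_card, Fintype.card_coe, List.toFinset_card_of_nodup oList_nodup, length_oList]

/-- Words in two elements of a subgroup stay in the subgroup. -/
theorem evalWord_mem {H : Subgroup (SL(2, ZMod 7))} {a b : SL(2, ZMod 7)} (ha : a ∈ H) (hb : b ∈ H) :
    ∀ w : List Bool, evalWord a b w ∈ H := by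
  intro w
  induction w with
  | nil => exact H.one_mem
  | cons c w ih =>
    cases c
    · exact H.mul_mem hb ih
    · exact H.mul_mem ha ih

/-- A subgroup containing `s` and `t` contains `Ostar` (every element of `oList` is a word in `s, t`). -/
theorem Ostar_le_of_mem {H : Subgroup (SL(2, ZMod 7))} (hs : s ∈ H) (ht : t ∈ H) : Ostar ≤ H := by
  intro x hx
  rw [mem_Ostar, ← wordsO_check, List.mem_map] at hx
  obtain ⟨w, -, rfl⟩ := hx
  exact evalWord_mem hs ht w

/-! ### The range of `ρ22` is exactly `O*` -/

/-- `s = ρ22 (x₂ x₃⁻¹)`. -/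
theorem s_mem_range : s ∈ ρ22.range :=
  ⟨PresentedGroup.of 2 * (PresentedGroup.of 3)⁻¹, by simp only [map_mul, map_inv, ρ22_of]; decide⟩

/-- `t = ρ22 (x₀ x₂ x₄⁻¹)`. -/
theorem t_mem_range : t ∈ ρ22.range :=
  ⟨PresentedGroup.of 0 * PresentedGroup.of 2 * (PresentedGroup.of 4)⁻¹, by
    simp only [map_mul, map_inv, ρ22_of]; decide⟩

/-- `O* ≤ range ρ22`. -/
theorem Ostar_le_range : Ostar ≤ ρ22.range := Ostar_le_of_mem s_mem_range t_mem_range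

/-- `range ρ22 ≤ O*` (the generators map into `oList`, which is a subgroup). -/
theorem range_le_Ostar : ρ22.range ≤ Ostar := by
  rw [MonoidHom.range_eq_map, ← PresentedGroup.closure_range_of, MonoidHom.map_closure,
    Subgroup.closure_le]
  rintro _ ⟨_, ⟨i, rfl⟩, rfl⟩
  show ρ22 (PresentedGroup.of i) ∈ Ostar
  rw [ρ22_of, mem_Ostar]
  exact M22_mem_oList i

/-- SURJECTIVITY ONTO `O*`: `range ρ22 = Ostar`, a group of order `48`. -/
theorem range_eq_Ostar : ρ22.range = Ostar := le_antisymm range_le_Ostar Ostar_le_range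

/-- `|range ρ22| = 48`. -/
theorem card_range : Nat.card ρ22.range = 48 := by
  rw [range_eq_Ostar, card_Ostar]

/-- `G22` is not abelian (two arc images do not commute), in particular not cyclic. -/
theorem G22_noncomm :
    (PresentedGroup.of 0 * PresentedGroup.of 2 : G22) ≠ PresentedGroup.of 2 * PresentedGroup.of 0 := by
  intro h
  have h' := congrArg ρ22 h
  simp only [map_mul, ρ22_of] at h'
  revert h'
  decide +kernel

end PretzelSurgery22
end Summit.SmoothPoincare4.SmoothPoincare4.Theorems
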